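import Literature.NumberTheory.EllipticCurves.Delbourgo2002.PAdicBSDLeadingTermIntrinsic
import Literature.NumberTheory.EllipticCurves.Disegni2017.CyclotomicLineRankinSelberg
import Literature.NumberTheory.EllipticCurves.PAdicHeightsK
import HarnessLib

/-!
# Scaling a `p`-adic height datum: Delbourgo's leading-term clauses are invariant under `p`-adic
# UNITS, Disegni's ratio clauses under a SIGN (bookkeeping lemmas, all proved; no named fact)

Topic `Literature/NumberTheory/EllipticCurves`, sub-directory `Delbourgo2002`. Filed by the literature
seat `bsd-addord-k1-rf` (cell `bsd-addord`, HOME `run/shared/lean/pub/bsd-addord/`) as the KERNEL form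
of row C7 of the D-audit `HOME/audit/D-AUDIT-hCyc-D17-Rem132-height-id.md` (sha16 of record in the
cell STATUS): the conjoined named fact `Disegni2017.delbourgoDatum_cycLineGrossZagier` asserts
`∃ (Dh, DhK), DhK.RestrictsToWith Dh 1 ∧ Delbourgo2002.LeadingTermClauses W p Dh ∧ … ∧
Disegni2017.CycLineGrossZagierClauses W K ι fE α DhK`; the audit identifies the printed witnesses up to
a SIGN left undetermined by the conventions (reciprocity map, Weil pairing `j` vs `−j`, orientation of
the cyclotomic logarithm). This file proves that every clause of that conjunction is stable under
`(Dh, DhK) ↦ (−Dh, −DhK)` — indeed the Delbourgo-side clauses are stable under ANY `p`-adic unit, because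
they see `Dh` only through `Reg_p(Dh) ≠ 0` and an identity `… = u · … · Reg_p(Dh) · …` with `u ∈ ℤ_pˣ`
existential, and `Reg_p(c • Dh) = cⁿ · Reg_p(Dh)` (Gram determinant). Nothing here is a new `Prop`
fact; D-0026 net debt `0`.

## Contents

* `WeierstrassCurve.PAdicHeightData.scale c D` / `WeierstrassCurve.PAdicHeightDataK.scale c DK`: the
  datum with pairing `c · ⟨·,·⟩` (`c : ℚ_[p]`); `RestrictsToWith` is preserved.
* `padicRegulatorOf_scale`, `exists_padicRegulator_scale`: `Reg(D.scale c) = c ^ n · Reg(D)`.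
* `schneiderConjecture_scale_iff` (`c ≠ 0`).
* `Delbourgo2002.LeadingTermClauses.scale`, `Delbourgo2002.LeadingTermClausesIntrinsic.scale`
  (`c : ℤ_[p]ˣ`).
* `Disegni2017.padicRatioClause_scale_neg_one`, `Disegni2017.CycLineGrossZagierClauses.scale_neg_one`
  (the sign `σ₀` absorbs `−1`).

## References

* [MazurTateTeitelbaum1986Invent] B. Mazur, J. Tate, J. Teitelbaum, Invent. Math. 84 (1986), §II.4
  (the `p`-adic regulator as a Gram determinant).
* [Delbourgo2002] D. Delbourgo, J. Number Theory 95 (2002), Theorem (B) p. 40 (leading term up to a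
  `p`-adic unit).
* [Disegni2017] D. Disegni, Compos. Math. 153 (2017), Theorem B (arXiv v3 PDF 9).
-/

noncomputable section

open scoped Classical

namespace WeierstrassCurve

variable {W : WeierstrassCurve ℚ} {p : ℕ} [Fact p.Prime]

namespace PAdicHeightData

/-- The height datum with pairing multiplied by the scalar `c ∈ ℚ_p` (e.g. `c = −1`: the opposite
orientation of the cyclotomic logarithm). [cite: MazurTateTeitelbaum1986Invent, §II.4] -/
def scale (c : ℚ_[p]) (D : PAdicHeightData W p) : PAdicHeightData W p where
  pairing := c • D.pairing
  symm P Q := by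
    simp only [AddMonoidHom.smul_apply, D.symm P Q]
  map_torsion P Q hP := by
    simp only [AddMonoidHom.smul_apply, D.map_torsion P Q hP, smul_zero]

/-- Unfolding: the scaled pairing is `c · ⟨P, Q⟩`. [cite: MazurTateTeitelbaum1986Invent, §II.4] -/
@[simp]
theorem scale_pairing_apply (c : ℚ_[p]) (D : PAdicHeightData W p) (P Q : W.toAffine.Point) :
    (D.scale c).pairing P Q = c * D.pairing P Q := by
  simp only [scale, AddMonoidHom.smul_apply, smul_eq_mul]

/-- The pairing matrix scales. [cite: MazurTateTeitelbaum1986Invent, §II.4] -/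
theorem pairingMatrix_scale (c : ℚ_[p]) (D : PAdicHeightData W p) {ι : Type*}
    (P : ι → W.toAffine.Point) : (D.scale c).pairingMatrix P = c • D.pairingMatrix P := by
  ext i j
  simp only [pairingMatrix, Matrix.of_apply, Matrix.smul_apply, scale_pairing_apply, smul_eq_mul]

end PAdicHeightData

/-- The regulator of a family of `n` points scales by `cⁿ` (determinant of a scaled Gram matrix).
[cite: MazurTateTeitelbaum1986Invent, §II.4] -/
theorem padicRegulatorOf_scale (c : ℚ_[p]) (D : PAdicHeightData W p) {ι : Type*} [Fintype ι]
    (P : ι → W.toAffine.Point) :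
    padicRegulatorOf (D.scale c) P = c ^ Fintype.card ι * padicRegulatorOf D P := by
  simp only [padicRegulatorOf, PAdicHeightData.pairingMatrix_scale, Matrix.det_smul]

/-- The `p`-adic regulator scales by a fixed power of the scalar (the size of the chosen
Mordell–Weil basis; exponent `0` in the junk branch). [cite: MazurTateTeitelbaum1986Invent, §II.4] -/
theorem exists_padicRegulator_scale (D : PAdicHeightData W p) :
    ∃ n : ℕ, ∀ c : ℚ_[p], padicRegulator (D.scale c) = c ^ n * padicRegulator D := by
  by_cases h : ∃ (n : ℕ) (P : Fin n → W.toAffine.Point), IsMordellWeilBasis P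
  · refine ⟨h.choose, fun c ↦ ?_⟩
    simp only [padicRegulator, dif_pos h, padicRegulatorOf_scale, Fintype.card_fin]
  · exact ⟨0, fun c ↦ by simp only [padicRegulator, dif_neg h, pow_zero, one_mul]⟩

/-- Non-degeneracy is invariant under a nonzero scalar. [cite: MazurTateTeitelbaum1986Invent, §II.4] -/
theorem schneiderConjecture_scale_iff {c : ℚ_[p]} (hc : c ≠ 0) (D : PAdicHeightData W p) :
    SchneiderConjecture (D.scale c) ↔ SchneiderConjecture D := by
  obtain ⟨n, hn⟩ := exists_padicRegulator_scale D
  simp only [SchneiderConjecture, hn c, ne_eq, mul_eq_zero, pow_eq_zero_iff', not_or, not_and,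
    not_not]
  exact ⟨fun h ↦ h.2, fun h ↦ ⟨fun h' ↦ absurd h' hc, h⟩⟩

namespace PAdicHeightDataK

variable {K : Type} [Field K] [NumberField K]

/-- The `K`-datum with pairing multiplied by `c ∈ ℚ_p`. [cite: MazurTateTeitelbaum1986Invent, §II.4] -/
def scale (c : ℚ_[p]) (DK : PAdicHeightDataK W p K) : PAdicHeightDataK W p K where
  pairing := c • DK.pairing
  symm P Q := by
    simp only [AddMonoidHom.smul_apply, DK.symm P Q]
  map_torsion P Q hP := by
    simp only [AddMonoidHom.smul_apply, DK.map_torsion P Q hP, smul_zero]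

/-- Unfolding: the scaled `K`-pairing is `c · ⟨P, Q⟩`. [cite: MazurTateTeitelbaum1986Invent, §II.4] -/
@[simp]
theorem scale_pairing_apply (c : ℚ_[p]) (DK : PAdicHeightDataK W p K)
    (P Q : (W.baseChange K).toAffine.Point) :
    (DK.scale c).pairing P Q = c * DK.pairing P Q := by
  simp only [scale, AddMonoidHom.smul_apply, smul_eq_mul]

/-- Scaling both data by the same scalar preserves the restriction relation with any factor.
[cite: PerrinRiou1987, §1.2] -/
theorem RestrictsToWith.scale {DK : PAdicHeightDataK W p K} {D : PAdicHeightData W p} {k : ℕ}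
    (h : DK.RestrictsToWith D k) (c : ℚ_[p]) : (DK.scale c).RestrictsToWith (D.scale c) k := by
  intro P Q
  rw [scale_pairing_apply, PAdicHeightData.scale_pairing_apply, h P Q]
  ring

end PAdicHeightDataK

end WeierstrassCurve

namespace Literature.NumberTheory.EllipticCurves

open WeierstrassCurve

variable {W : WeierstrassCurve ℚ} {p : ℕ} [Fact p.Prime]

/-- Coercion bookkeeping: for units `u, v` of `ℤ_p`, `↑(u * v⁻¹) * ↑v = ↑u` in `ℚ_p`. [folklore] -/
private theorem coe_units_mul_inv_mul (u v : ℤ_[p]ˣ) :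
    (((u * v⁻¹ : ℤ_[p]ˣ) : ℤ_[p]) : ℚ_[p]) * ((v : ℤ_[p]) : ℚ_[p]) = ((u : ℤ_[p]) : ℚ_[p]) := by
  have h : ((u * v⁻¹ : ℤ_[p]ˣ) : ℤ_[p]) * (v : ℤ_[p]) = (u : ℤ_[p]) := by
    rw [← Units.val_mul, inv_mul_cancel_right]
  rw [← PadicInt.coe_mul, h]

namespace Delbourgo2002

/-- **Delbourgo's leading-term clauses are invariant under scaling the height datum by a `p`-adic
unit** (`Reg_p` acquires the unit `cⁿ`, absorbed in the existential `u ∈ ℤ_pˣ`; `Reg_p ≠ 0` is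
unchanged). [cite: Delbourgo2002, Theorem (B) (p. 40)] -/
theorem LeadingTermClauses.scale {Dh : PAdicHeightData W p} (h : LeadingTermClauses W p Dh)
    (c : ℤ_[p]ˣ) : LeadingTermClauses W p (Dh.scale ((c : ℤ_[p]) : ℚ_[p])) := by
  obtain ⟨n, hn⟩ := exists_padicRegulator_scale Dh
  have hc0 : ((c : ℤ_[p]) : ℚ_[p]) ≠ 0 := PadicInt.coe_ne_zero.mpr c.ne_zero
  have hS := schneiderConjecture_scale_iff hc0 Dh
  intro κ γ hκ hγ hγ' D _ hX fE hf
  obtain ⟨h1, h2, h3⟩ := h κ γ hκ hγ hγ' D hX fE hf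
  refine ⟨h1, by rw [hS]; exact h2, fun hS' hfin ↦ ?_⟩
  obtain ⟨u, ℓ, hℓp, hℓ, heq⟩ := h3 (hS.mp hS') hfin
  refine ⟨u * (c ^ n)⁻¹, ℓ, hℓp, hℓ, ?_⟩
  have key := coe_units_mul_inv_mul u (c ^ n)
  rw [Units.val_pow_eq_pow_val, PadicInt.coe_pow] at key
  rw [heq, hn]
  linear_combination ((ℓ : ℚ_[p]) * ((Nat.card (AddCommGroup.primaryComponent W.sha p) : ℚ_[p]) *
    padicRegulator Dh * W.tamagawaProduct)) * key.symm

/-- The intrinsic form of the clauses is likewise invariant under a `p`-adic unit.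
[cite: Delbourgo2002, Theorem (B) (p. 40), p. 67 (iv), p. 69] -/
theorem LeadingTermClausesIntrinsic.scale {Dh : PAdicHeightData W p}
    (h : LeadingTermClausesIntrinsic W p Dh) (c : ℤ_[p]ˣ) :
    LeadingTermClausesIntrinsic W p (Dh.scale ((c : ℤ_[p]) : ℚ_[p])) := by
  obtain ⟨n, hn⟩ := exists_padicRegulator_scale Dh
  have hc0 : ((c : ℤ_[p]) : ℚ_[p]) ≠ 0 := PadicInt.coe_ne_zero.mpr c.ne_zero
  have hS := schneiderConjecture_scale_iff hc0 Dh
  intro κ γ hκ hγ hγ' D _ hX fE hf v hv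
  obtain ⟨h1, h2, h3⟩ := h κ γ hκ hγ hγ' D hX fE hf v hv
  refine ⟨h1, by rw [hS]; exact h2, fun hS' hfin ↦ ?_⟩
  obtain ⟨hidx, u, heq⟩ := h3 (hS.mp hS') hfin
  refine ⟨hidx, u * (c ^ n)⁻¹, ?_⟩
  have key := coe_units_mul_inv_mul u (c ^ n)
  rw [Units.val_pow_eq_pow_val, PadicInt.coe_pow] at key
  rw [heq, hn]
  linear_combination (((localUniversalNormIndex (W := W) (v.adicCompletion ℚ) κ ⊤ : ℚ_[p]) /
      (W.tamagawaNumberAt v : ℚ_[p])) *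
    ((Nat.card (AddCommGroup.primaryComponent W.sha p) : ℚ_[p]) * padicRegulator Dh *
      W.tamagawaProduct)) * key.symm

end Delbourgo2002

namespace Disegni2017

variable {K : Type} [Field K] [NumberField K] {N : ℕ}

/-- **Disegni's `p`-adic ratio clause is invariant under `(DhK, σ₀) ↦ (−DhK, −σ₀)`** (the universal
sign absorbs the orientation). [cite: Disegni2017, Theorem B (arXiv v3 PDF p. 9)] -/
theorem padicRatioClause_scale_neg_one {α : ℚ_[p]} {G : PowerSeries ℂ_[p]}
    {DhK : PAdicHeightDataK W p K} {P₁ P₂ : (W.baseChange K).toAffine.Point} {q : ℚ} {σ₀ : ℤˣ}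
    (h : PAdicRatioClause W K α G DhK P₁ P₂ q σ₀) :
    PAdicRatioClause W K α G (DhK.scale (-1)) P₁ P₂ q (-σ₀) := by
  rw [padicRatioClause_iff] at h ⊢
  rw [PAdicHeightDataK.scale_pairing_apply, neg_one_mul, map_neg, h, Units.val_neg, Int.cast_neg]
  ring

/-- **The conjunction `CycLineGrossZagierClauses` is invariant under `DhK ↦ −DhK`** (same `Car`, `G`,
points and `q`; sign `σ₀ ↦ −σ₀`). [cite: Disegni2017, Theorem A/B (arXiv v3 PDF pp. 7–9)] -/
theorem CycLineGrossZagierClauses.scale_neg_one [IsGalois ℚ K] {ι : PadicAlgCl p ≃+* ℂ}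
    {fE : CuspForm (CongruenceSubgroup.Gamma0 N) 2} {α : ℚ_[p]} {DhK : PAdicHeightDataK W p K}
    (h : CycLineGrossZagierClauses W K ι fE α DhK) :
    CycLineGrossZagierClauses W K ι fE α (DhK.scale (-1)) := by
  obtain ⟨Car, hCar, G, hG, P₁, P₂, q, σ₀, hq, hA, hP⟩ := h
  exact ⟨Car, hCar, G, hG, P₁, P₂, q, -σ₀, hq, hA, padicRatioClause_scale_neg_one hP⟩

/-- **Row C7 of the audit, kernel form**: the conclusion shape of
`Disegni2017.delbourgoDatum_cycLineGrossZagier` is invariant under reversing the sign of BOTH data —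
if `(Dh, DhK)` satisfies «`DhK` restricts to `Dh` with factor `1` ∧ Delbourgo's clauses for `Dh` ∧
(intrinsic clauses for `Dh` under a side condition) ∧ Disegni's clauses for `DhK`», so does
`(−Dh, −DhK)`. [cite: Delbourgo2002, Theorem (B) (p. 40)] [cite: Disegni2017, Theorem B (arXiv v3 PDF p. 9)] -/
theorem cycLineDatumClauses_neg [IsGalois ℚ K] {ι : PadicAlgCl p ≃+* ℂ}
    {fE : CuspForm (CongruenceSubgroup.Gamma0 N) 2} {α : ℚ_[p]} {S : Prop}
    {Dh : PAdicHeightData W p} {DhK : PAdicHeightDataK W p K}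
    (h : DhK.RestrictsToWith Dh 1 ∧ Delbourgo2002.LeadingTermClauses W p Dh ∧
      (S → Delbourgo2002.LeadingTermClausesIntrinsic W p Dh) ∧
      CycLineGrossZagierClauses W K ι fE α DhK) :
    (DhK.scale (-1)).RestrictsToWith (Dh.scale (-1)) 1 ∧
      Delbourgo2002.LeadingTermClauses W p (Dh.scale (-1)) ∧
      (S → Delbourgo2002.LeadingTermClausesIntrinsic W p (Dh.scale (-1))) ∧
      CycLineGrossZagierClauses W K ι fE α (DhK.scale (-1)) := by
  obtain ⟨h1, h2, h3, h4⟩ := h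
  have hneg : (((-1 : ℤ_[p]ˣ) : ℤ_[p]) : ℚ_[p]) = -1 := by push_cast [Units.val_neg, Units.val_one]; rfl
  refine ⟨h1.scale (-1), ?_, fun hS ↦ ?_, h4.scale_neg_one⟩
  · simpa only [hneg] using h2.scale (-1)
  · simpa only [hneg] using (h3 hS).scale (-1)

end Disegni2017

end Literature.NumberTheory.EllipticCurves

end
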